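import Literature.NumberTheory.Automorphic.Liu2021.AlbaneseBaseChangeFiniteGalois
import HarnessLib

/-!
# The Albanese variety over a finite Galois splitting field is the product of the Jacobians of the pieces —
# COMPATIBLY WITH THE ALBANESE MORPHISM (Liu 2021, §2.1), from three compatibility inputs

Topic `Literature/NumberTheory/Automorphic/Liu2021`; namespace `Literature.NumberTheory.Automorphic.Liu2021.AppendixC`.
PROOF FILE: theorems only, sorry-free.  Sequel of `AlbaneseBaseChangeFiniteGalois.lean`
(`Albanese.exists_isGalois_isLimit_fan_baseChange`: for ANY Albanese datum `a` of `X`, a finite Galois `L / k`, pointed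
pieces `e_c : E_c ⟶ X_L`, Jacobians `𝒥_c` and a LIMIT FAN `π_c : a.Alb ×_k L ⟶ J(E_c)`).  That theorem asserts no
compatibility between the fan and the Albanese MORPHISM `α_X`; the (G)-road of the III-0 input (cell `hodgecm-mathlib`,
A-p18's census 2026-08-28T07:02:43Z) needs exactly this compatibility: through the chart `E_c × E_c ⊆ (∇X)_L`, the composite
`(α_X)_L ≫ π_{c'}` is the DIFFERENCE MAP of `𝒥_c` for `c' = c` and trivial for `c' ≠ c` («the fan isomorphism
`(Alb_X)_L ≅ ∏_c J(E_c)` is compatible with `α`»).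

This file proves the COMPATIBLE fan (`Albanese.exists_isGalois_isLimit_fan_baseChange_compat_of`) from the SAME assembly
as the tree theorem, given the three compatibility facts that the tree's existence theorems currently hide under `Nonempty`,
taken here as HYPOTHESES in the exact shape of their planned exposures ((G1)–(G3) of the road):

* `hG1` — `Albanese.exists_of_isColimit` WITH its charts: the constructed datum `a″` of a split scheme `X′ = ∐ Y_c` comes with
  `l_c : Y_c × Y_c ⟶ ∇X′` over `inj_c × inj_c`, and `l_c ≫ α″ ≫ π″_{c'}` is `𝒥_c.diff` for `c' = c`, trivial otherwise;
* `hG2` — `Albanese.exists_iso_baseChange_of_albanese_baseChange` WITH the compatibility of the descent isomorphism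
  `i : a′.Alb ≅ a₀.Alb ×_k L` with the Albanese morphisms (through the given `∇`-comparison `e` and a `∇`-identification `e₀`);
* `hG3` — `Albanese.nonempty_iso` WITH `a₁.α ≫ j = e ≫ a₂.α` for the `∇`-isomorphism `e` of `Nabla.exists_iso`.

Given these, the compatibility threads through the assembly by diagram chase: the chart of `E_c × E_c` in `(∇X)_L` is
`l″_c ≫ e′⁻¹ ≫ (e₀⁻¹)_L ≫ (e₃⁻¹)_L`, unique because `(∇X ↪ X × X)_L` is a monomorphism (`Nabla.exists_of_nabla_baseChange_incl`
supplies the compatibility of the `∇`-descent with the inclusions).  When (G1)–(G3) land, the unconditional compatible fan is the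
five-line instantiation of this theorem.  Ours; nothing of [Liu2021] is asserted.

## References
* [Liu2021] Y. Liu, arXiv:2102.11518 = Camb. J. Math. 9 (2021): §2.1 Def. 2.1 (1), Proposition (l. 1190–1192) with proof
  (l. 1194–1200), Def. 2.3 (l. 1202–1208).
* [Milne1986JacobianVarieties] J. S. Milne, *Jacobian Varieties* (1986), §6 Prop. 6.4, Remark 6.5.
-/

noncomputable section

open CategoryTheory CategoryTheory.Limits AlgebraicGeometry MonoidalCategory CartesianMonoidalCategory
open Literature.AlgebraicGeometry.Motives

namespace Literature.NumberTheory.Automorphic.Liu2021.AppendixC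

open AbelianVariety (bcSpec bcFunctor)
open scoped MonObj

set_option backward.isDefEq.respectTransparency false

/-- For a `∇X` of `X` smooth of relative dimension `d` over `k` and a field extension `L / k`: `(∇X)_L` is reduced and
`∇X → Spec k` is locally of finite type (private twin of the lemma of `AlbaneseBaseChangeFiniteGalois`). [folklore] -/
private theorem Nabla.isReduced_bc_and_locallyOfFiniteType'' {k : Type} [Field k] (L : Type) [Field L] [Algebra k L]
    {d : ℕ} {X : SchemeOver k} [SmoothOfRelativeDimension d X.hom] (N : Nabla X) :
    IsReduced (GaloisDescent.bc L N.N) ∧ LocallyOfFiniteType N.N.hom := by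
  haveI := N.isOpenImmersion_incl
  haveI := smoothOfRelativeDimension_isStableUnderBaseChange (n := d)
  haveI : SmoothOfRelativeDimension d (pullback.fst X.hom X.hom) :=
    MorphismProperty.pullback_fst _ _ ‹_›
  haveI : SmoothOfRelativeDimension (d + d) (X ⊗ X).hom := by
    rw [Over.tensorObj_hom]; infer_instance
  haveI : SmoothOfRelativeDimension (d + d) ((bcFunctor k L).obj (X ⊗ X)).hom := by
    haveI := smoothOfRelativeDimension_isStableUnderBaseChange (n := d + d)
    exact MorphismProperty.pullback_snd _ _ ‹_›
  haveI : IsReduced ((bcFunctor k L).obj (X ⊗ X)).left :=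
    isReduced_of_smoothOfRelativeDimension ((bcFunctor k L).obj (X ⊗ X)).hom (d + d)
  haveI := GaloisDescent.isOpenImmersion_bcFunctor_map_left L N.incl
  haveI : Smooth (X ⊗ X).hom := SmoothOfRelativeDimension.smooth (d + d) _
  refine ⟨isReduced_of_isOpenImmersion ((bcFunctor k L).map N.incl).left, ?_⟩
  rw [← Over.w N.incl]
  infer_instance

/-- composition of morphisms of abelian varieties, read on the underlying `k`-schemes (bookkeeping). [folklore] -/
private theorem comp_hom_hom_hom' {k : Type} [Field k] {A B C : AbelianVariety k} (f : A ⟶ B) (g : B ⟶ C) :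
    (f ≫ g).hom.hom.hom = f.hom.hom.hom ≫ g.hom.hom.hom := rfl

/-- **[Liu2021, §2.1] The α-COMPATIBLE finite-Galois Albanese fan, from the three compatibility inputs (G1)–(G3).**
For `X` smooth of relative dimension `d` and projective over a field `k` of characteristic zero with `[Algebra k ℂ]` and ANY
`a : Albanese X`: GIVEN (G1) the split-scheme existence theorem with the α-compatibility of its charts
(`Albanese.exists_of_isColimit_compat`, A-p09's head), (G2) the Galois descent of a datum WITH the comparison of the Albanese
morphisms along the descent isomorphism and the `∇`-comparison (incl- and α-clauses), (G3) uniqueness of `Alb_X` WITH the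
α-compatibility (`Albanese.exists_iso_compat`, B-typ03's head) — there are a finite Galois `L / k`, a colimit cofan
`e_c : E_c ⟶ X_L` of pointed smooth projective geometrically irreducible pieces, Jacobians `𝒥_c`, a LIMIT FAN
`π_c : a.Alb ×_k L ⟶ J(E_c)`, AND for every `c`: a chart `l : E_c × E_c ⟶ (∇X)_L` over `e_c × e_c` (through
`X_L × X_L ⥲ (X × X)_L`) exists, and for EVERY such chart `l ≫ (α_X)_L ≫ π_c = 𝒥_c.diff` while `l ≫ (α_X)_L ≫ π_{c'}` is trivial
for `c' ≠ c`.  Ours (the assembly of `exists_isGalois_isLimit_fan_baseChange`, threading the compatibilities).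
[cite: Liu2021, §2.1 Proposition (FJcycle.tex l. 1190–1192) with proof (l. 1194–1200), Def. 2.3 (l. 1202–1208)]
[cite: Milne1986JacobianVarieties, Remark 1.9, §6 Prop. 6.4 and Remark 6.5] -/
theorem Albanese.exists_isGalois_isLimit_fan_baseChange_compat_of {k : Type} [Field k] [CharZero k] [Algebra k ℂ]
    {d : ℕ} (X : SchemeOver k) [SmoothOfRelativeDimension d X.hom] (hX : IsProjectiveOver X) (a : Albanese X)
    (hG1 : ∀ (L : Type) [Field L] [Algebra k L] {κ : Type} [Fintype κ] {X' : SchemeOver L} {Y : κ → SchemeOver L}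
      (inj : ∀ c, Y c ⟶ X') (_ : IsColimit (Cofan.mk X' inj)) (𝒥 : ∀ c, Jacobian (Y c))
      (_ : ∀ c, GeometricallyIrreducible (Y c).hom),
      ∃ (a' : Albanese X') (π : ∀ c, a'.Alb ⟶ (𝒥 c).J), Nonempty (IsLimit (Fan.mk a'.Alb π)) ∧
        ∀ (c : κ) (l : Y c ⊗ Y c ⟶ a'.nabla.N), l ≫ a'.nabla.incl = (inj c ⊗ₘ inj c) →
          l ≫ a'.α ≫ (π c).hom.hom.hom = (𝒥 c).diff ∧ ∀ c', c' ≠ c → l ≫ a'.α ≫ (π c').hom.hom.hom = 1)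
    (hG2 : ∀ (L : Type) [Field L] [Algebra k L] [FiniteDimensional k L] [IsGalois k L] (N : Nabla X)
      [IsReduced (GaloisDescent.bc L N.N)] [LocallyOfFiniteType N.N.hom] (a' : Albanese ((bcFunctor k L).obj X))
      (e : (bcFunctor k L).obj N.N ≅ a'.nabla.N) (_ : (bcFunctor k L).map N.diag ≫ e.hom = a'.nabla.diag)
      (_ : e.hom ≫ a'.nabla.incl ≫ Functor.LaxMonoidal.μ (bcFunctor k L) X X = (bcFunctor k L).map N.incl),
      ∃ (a₀ : Albanese X) (e₀ : (bcFunctor k L).obj a₀.nabla.N ≅ a'.nabla.N) (i : a'.Alb ≅ a₀.Alb.baseChange L),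
        e₀.hom ≫ a'.nabla.incl ≫ Functor.LaxMonoidal.μ (bcFunctor k L) X X = (bcFunctor k L).map a₀.nabla.incl ∧
          (bcFunctor k L).map a₀.α ≫ i.inv.hom.hom.hom = e₀.hom ≫ a'.α)
    (hG3 : ∀ a₁ a₂ : Albanese X, ∃ (e : a₁.nabla.N ≅ a₂.nabla.N) (j : a₁.Alb ≅ a₂.Alb),
      e.hom ≫ a₂.nabla.incl = a₁.nabla.incl ∧ a₁.nabla.diag ≫ e.hom = a₂.nabla.diag ∧
        a₁.α ≫ j.hom.hom.hom.hom = e.hom ≫ a₂.α) :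
    ∃ (L : Type) (_ : Field L) (_ : Algebra k L) (_ : FiniteDimensional k L) (_ : IsGalois k L)
      (C : Type) (_ : Fintype C) (E : C → SchemeOver L) (e : ∀ c, E c ⟶ (bcFunctor k L).obj X)
      (_ : ∀ c, IsSmoothProjective d (E c)) (_ : Nonempty (IsColimit (Cofan.mk ((bcFunctor k L).obj X) e)))
      (_ : ∀ c, AlgPoints (E c) L) (𝒥 : ∀ c, Jacobian (E c)) (π : ∀ c, a.Alb.baseChange L ⟶ (𝒥 c).J),
      Nonempty (IsLimit (Fan.mk (a.Alb.baseChange L) π)) ∧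
        ∀ c, (∃ l : E c ⊗ E c ⟶ (bcFunctor k L).obj a.nabla.N,
            l ≫ (bcFunctor k L).map a.nabla.incl = (e c ⊗ₘ e c) ≫ Functor.LaxMonoidal.μ (bcFunctor k L) X X) ∧
          ∀ l : E c ⊗ E c ⟶ (bcFunctor k L).obj a.nabla.N,
            l ≫ (bcFunctor k L).map a.nabla.incl = (e c ⊗ₘ e c) ≫ Functor.LaxMonoidal.μ (bcFunctor k L) X X →
              l ≫ (bcFunctor k L).map a.α ≫ (π c).hom.hom.hom = (𝒥 c).diff ∧
                ∀ c', c' ≠ c → l ≫ (bcFunctor k L).map a.α ≫ (π c').hom.hom.hom = 1 := by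
  -- split `X` over a finite Galois `L / k`, with pointed pieces
  obtain ⟨L, _, _, _, _, C, _, E, e, hE, hP, ⟨hcol⟩⟩ :=
    exists_isGalois_isColimit_isSmoothProjective_algPoints (d := d) X hX
  haveI : Fintype C := Fintype.ofFinite C
  haveI : ∀ c, GeometricallyIrreducible (E c).hom := fun c => (hE c).geometricallyIrreducible
  -- Albanese data of the pieces, along a `k`-embedding `L → ℂ`
  letI : Algebra L ℂ := ((IsAlgClosed.lift : L →ₐ[k] ℂ) : L →+* ℂ).toAlgebra
  have 𝒥 : ∀ c, Jacobian (E c) := fun c =>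
    (nonempty_jacobian_of_isSmoothProjective_of_algebra_complex (hE c)).some
  -- (G1) Liu's datum of the split scheme `X_L`, with `Alb = ∏_c J(E_c)` AND the compatibility of its charts
  obtain ⟨a'', π'', ⟨hlim''⟩, hG1c⟩ := hG1 L e hcol 𝒥 inferInstance
  -- descend `∇(X_L)` to `k`, keeping the comparison isomorphism AND its compatibility with the inclusions
  obtain ⟨N, e', he'incl, he'⟩ := Nabla.exists_of_nabla_baseChange_incl L a''.nabla
  obtain ⟨h1, h2⟩ := Nabla.isReduced_bc_and_locallyOfFiniteType'' L (d := d) N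
  haveI := h1
  haveI := h2
  -- (G2) descend the datum, keeping the comparison `i` AND its compatibilities
  obtain ⟨a₀, e₀, i, he₀incl, hi⟩ := hG2 L N a'' e' he' he'incl
  -- (G3) `a.Alb ≅ a₀.Alb` over `k`, compatibly with `α` and the inclusions
  obtain ⟨e₃, j, he₃, -, hj⟩ := hG3 a a₀
  let θ : a.Alb.baseChange L ≅ a''.Alb := (AbelianVariety.baseChangeFunctor k L).mapIso j ≪≫ i.symm
  -- bookkeeping shared by both clauses
  haveI : IsIso (Functor.LaxMonoidal.μ (bcFunctor k L) X X) :=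
    (Functor.Monoidal.μIso (bcFunctor k L) X X).isIso_hom
  have hincl₀ : (bcFunctor k L).map e₃.hom ≫ (bcFunctor k L).map a₀.nabla.incl = (bcFunctor k L).map a.nabla.incl := by
    rw [← Functor.map_comp, he₃]
  refine ⟨L, inferInstance, inferInstance, inferInstance, inferInstance, C, inferInstance, E, e, hE, ⟨hcol⟩,
    fun c => (hP c).some, 𝒥, fun c => θ.hom ≫ π'' c, ⟨?_, fun c => ⟨?_, ?_⟩⟩⟩
  · exact ⟨IsLimit.ofIsoLimit hlim'' (Fan.ext θ.symm fun c => (θ.inv_hom_id_assoc (π'' c)).symm)⟩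
  · -- existence of the chart: transport the canonical chart of `E c × E c` in `∇(X_L)` back to `(∇X)_L`
    obtain ⟨l₁, hl₁⟩ := exists_lift_tensorHom (inj := e) a''.nabla c
    refine ⟨l₁ ≫ e₀.inv ≫ (bcFunctor k L).map e₃.inv, ?_⟩
    have h3 : (bcFunctor k L).map e₃.inv ≫ (bcFunctor k L).map a.nabla.incl = (bcFunctor k L).map a₀.nabla.incl := by
      rw [← hincl₀, ← Category.assoc, ← Functor.map_comp, e₃.inv_hom_id, CategoryTheory.Functor.map_id, Category.id_comp]
    simp only [Category.assoc]
    rw [h3, ← he₀incl, e₀.inv_hom_id_assoc, reassoc_of% hl₁]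
  · -- the compatibility, for ANY chart `l`
    intro l hl
    -- the transported chart `l″ := l ≫ (e₃)_L ≫ e₀` is a chart of `E c × E c` in `∇(X_L)`
    have hl'' : (l ≫ (bcFunctor k L).map e₃.hom ≫ e₀.hom) ≫ a''.nabla.incl = e c ⊗ₘ e c := by
      rw [← cancel_mono (Functor.LaxMonoidal.μ (bcFunctor k L) X X), Category.assoc, ← hl]
      simp only [Category.assoc]
      rw [he₀incl, hincl₀]
    obtain ⟨hdiag, hoff⟩ := hG1c c _ hl''
    -- `(α_X)_L ≫ θ = (e₃)_L ≫ e₀ ≫ α″`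
    have hθ : θ.hom.hom.hom.hom = (bcFunctor k L).map j.hom.hom.hom.hom ≫ i.inv.hom.hom.hom := by
      change ((AbelianVariety.baseChangeFunctor k L).map j.hom ≫ i.inv).hom.hom.hom = _
      rw [comp_hom_hom_hom']
      rfl
    have hαθ : (bcFunctor k L).map a.α ≫ θ.hom.hom.hom.hom =
        (bcFunctor k L).map e₃.hom ≫ e₀.hom ≫ a''.α := by
      rw [hθ, ← Category.assoc, ← Functor.map_comp, hj, Functor.map_comp, Category.assoc, hi]
    have hkey : ∀ c', l ≫ (bcFunctor k L).map a.α ≫ (θ.hom ≫ π'' c').hom.hom.hom =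
        (l ≫ (bcFunctor k L).map e₃.hom ≫ e₀.hom) ≫ a''.α ≫ (π'' c').hom.hom.hom := by
      intro c'
      rw [comp_hom_hom_hom', ← Category.assoc ((bcFunctor k L).map a.α), hαθ]
      simp only [Category.assoc]
    refine ⟨?_, fun c' hc' => ?_⟩
    · rw [hkey c, hdiag]
    · rw [hkey c', hoff c' hc']

end Literature.NumberTheory.Automorphic.Liu2021.AppendixC

end
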